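import Mathlib
import Literature.Geometry.ComplexHyperbolic.UnitBallIsotropy
import Literature.Topology.Algebra.DenseSubgroupLineField
import HarnessLib

/-!
# Dense-subgroup-stable spaces of cotangent fields on the complex `2`-ball have a non-zero wedge

The abstract line-field theorem `Literature.Topology.Algebra.DenseSubgroup.exists_wedge_ne_zero_of_SU2`
(dense subgroup `Δ` of a topological group `G` acting transitively and continuously on `X`, an injective
continuous fibre cocycle `A`, an `SU(2)` inside the isotropy representation at a base point, two non-zero
`Δ`-stable spaces `𝒰₁, 𝒰₂` of continuous sections `X → W` ⇒ some `u₁(x) ∧ u₂(x) ≠ 0`) SPECIALISED to the canonical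
model of `Literature/Geometry/ComplexHyperbolic/UnitBall{U21,Jacobian,Isotropy}.lean`: `G = U(2,1)`, `X = 𝔹²`,
`W = ℂ² = T^*𝔹²`, `A g z = (J_g(z)ᵀ)⁻¹` the transpose-inverse Jacobian cocycle (`BallModel.A`), base point `x₀ = 0`
with `SU(2) ↪ Stab(x₀)` acting on `T^*_{x₀}` through itself (`BallModel.isotropy_SU2`).

* **`BallModel.exists_wedge_ne_zero`** : for every DENSE subgroup `Δ ≤ U(2,1)` and all non-zero submodules
  `𝒰₁, 𝒰₂ ≤ (𝔹² → ℂ²)` of continuous fields stable under `Δ` (for the cocycle `A`), there are `uᵢ ∈ 𝒰ᵢ` and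
  `x ∈ 𝔹²` with `u₁ x, u₂ x` linearly independent.

All inputs are tree theorems (`BallModel.transitive`, `A_injective`, `A_continuous`, `isotropy_SU2` and the
abstract theorem); the proof is the one-line instantiation. [folklore]

## Provenance

Staged by the pub-hodgecm formalisation cell (DAG-node prover #01 lineage, with the ball model of the #03 lineage)
under the LEAN-IN-TREE rule; it is the unconditional tree form of the cell's package assembly
`HodgeCM/PerL34/BallGlue.lean` `n33e_ball` (there stated under the hypothesis "the abstract line-field statement
holds", which is now the tree theorem `exists_wedge_ne_zero_of_SU2`).

## Not here

Which dense subgroup `Δ` is used (for the image of the `L`-points of a CM-unitary group along a frame see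
`Literature/GroupTheory/ArithmeticGroups/UnitaryRealApproximationFrameImage.lean`, `dense_range_toFrameUnitary`
with `S = U21`, `hS = fun _ => Iff.rfl`); where the spaces `𝒰ᵢ` come from.
-/

set_option autoImplicit false

noncomputable section

namespace Literature.Geometry.ComplexHyperbolic

namespace BallModel

open Literature.Topology.Algebra

/-- **Non-zero wedge on the ball.**  For a dense subgroup `Δ ≤ U(2,1)` and two non-zero `Δ`-stable submodules of
continuous cotangent fields `𝔹² → ℂ²` (stability for the transpose-inverse Jacobian cocycle `A`:
`∀ γ ∈ Δ, ∀ u ∈ 𝒰, ∃ u' ∈ 𝒰, ∀ z, u' (γ • z) = A γ z (u z)`), some `u₁ ∈ 𝒰₁`, `u₂ ∈ 𝒰₂` are linearly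
independent at some point. [folklore] -/
theorem exists_wedge_ne_zero (Δ : Subgroup U21) (hΔ : Dense (Δ : Set U21))
    (𝒰₁ 𝒰₂ : Submodule ℂ (Ball → (Fin 2 → ℂ))) (h₁ : ∀ u ∈ 𝒰₁, Continuous u) (h₂ : ∀ u ∈ 𝒰₂, Continuous u)
    (s₁ : DenseSubgroup.StableUnder Δ A 𝒰₁) (s₂ : DenseSubgroup.StableUnder Δ A 𝒰₂) (n₁ : 𝒰₁ ≠ ⊥) (n₂ : 𝒰₂ ≠ ⊥) :
    ∃ u₁ ∈ 𝒰₁, ∃ u₂ ∈ 𝒰₂, ∃ x : Ball, LinearIndependent ℂ ![u₁ x, u₂ x] :=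
  DenseSubgroup.exists_wedge_ne_zero_of_SU2 Δ hΔ transitive A A_injective x₀ (A_continuous x₀)
    (LinearEquiv.refl ℂ (Fin 2 → ℂ)) (fun g hg => by simpa using isotropy_SU2 g hg) 𝒰₁ 𝒰₂ h₁ h₂ s₁ s₂ n₁ n₂

/-- `u, v ∈ ℂ²` are linearly independent iff their wedge `u₀ v₁ - u₁ v₀` is non-zero. [folklore] -/
theorem linearIndependent_pair_iff_wedge_ne_zero (a b : Fin 2 → ℂ) :
    LinearIndependent ℂ ![a, b] ↔ wedge a b ≠ 0 := by
  have h : LinearIndependent ℂ (fun i => Matrix.of ![a, b] i) ↔ IsUnit (Matrix.of ![a, b]) :=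
    Matrix.linearIndependent_rows_iff_isUnit
  have hfun : (fun i => Matrix.of ![a, b] i) = ![a, b] := funext fun i => rfl
  rw [hfun, Matrix.isUnit_iff_isUnit_det, isUnit_iff_ne_zero, Matrix.det_fin_two] at h
  simpa [wedge] using h

/-- The same with the conclusion as a non-vanishing wedge (`BallModel.wedge`, a `2 × 2` determinant). [folklore] -/
theorem exists_wedge_ne_zero' (Δ : Subgroup U21) (hΔ : Dense (Δ : Set U21))
    (𝒰₁ 𝒰₂ : Submodule ℂ (Ball → (Fin 2 → ℂ))) (h₁ : ∀ u ∈ 𝒰₁, Continuous u) (h₂ : ∀ u ∈ 𝒰₂, Continuous u)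
    (s₁ : DenseSubgroup.StableUnder Δ A 𝒰₁) (s₂ : DenseSubgroup.StableUnder Δ A 𝒰₂) (n₁ : 𝒰₁ ≠ ⊥) (n₂ : 𝒰₂ ≠ ⊥) :
    ∃ u₁ ∈ 𝒰₁, ∃ u₂ ∈ 𝒰₂, ∃ x : Ball, wedge (u₁ x) (u₂ x) ≠ 0 := by
  obtain ⟨u₁, hu₁, u₂, hu₂, x, hx⟩ := exists_wedge_ne_zero Δ hΔ 𝒰₁ 𝒰₂ h₁ h₂ s₁ s₂ n₁ n₂
  exact ⟨u₁, hu₁, u₂, hu₂, x, (linearIndependent_pair_iff_wedge_ne_zero _ _).mp hx⟩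

end BallModel

end Literature.Geometry.ComplexHyperbolic
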